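import Summits.CriticalPhenomena.SAWScalingLimit.Theorems.SAWCompassLatticeSurfaceUniversalityDefs

/-!
# Sketch — crux idea `critical-surface-orthogonality` for `YBtoUniform` (stmt-CriticalPhenomena-16966)

First-lemma candidates of the idea card (crux-ideate round 1, ideator 1). Nothing here is a
registered stub; the file only has to ELABORATE. Objects are those of the landed
`Theorems/SAWCompassLatticeSurfaceUniversalityDefs.lean` (`fwLocalWeight`, `fwWeight`, `fwLaw`,
`unifLaw`, `LipUnifToYB` = the kernel K of line `birth`).
-/

noncomputable section

namespace Summit.CriticalPhenomena.SAWScalingLimit.Cruxes.YBtoUniform.CriticalSurfaceOrthogonality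

open MeasureTheory Filter Topology Set
open scoped NNReal ENNReal BoundedContinuousFunction
open Literature.Probability.RandomPlanarGeometry
open Literature.Probability.RandomPlanarGeometry.SAW
open Literature.Probability.RandomPlanarGeometry.SAW.YangBaxter
open Literature.Probability.LatticeModels (Site)
open Summit.CriticalPhenomena.SAWScalingLimit.Theses
open Summit.CriticalPhenomena.SAWScalingLimit.Theorems.SurfaceUniversality

/-! ### Pattern counts of a face walk (the three D4-symmetric local patterns) -/

section Counts

variable {D : Set Face} {a z : MidEdge}

/-- Number of faces of `γ` carrying exactly one TURNING arc (weight `u₁` or `u₂`). -/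
def turnCount (γ : YBWalk D a z) : ℕ :=
  (γ.facesVisited.filter fun f => γ.kindsIn f = [.corner] ∨ γ.kindsIn f = [.coCorner]).card

/-- Number of faces of `γ` crossed STRAIGHT (weight `v`). -/
def straightCount (γ : YBWalk D a z) : ℕ :=
  (γ.facesVisited.filter fun f => γ.kindsIn f = [.straight]).card

/-- Number of OSCULATION faces of `γ` (two arcs; weight `w₁` or `w₂`). -/
def oscCount (γ : YBWalk D a z) : ℕ :=
  (γ.facesVisited.filter fun f => (γ.kindsIn f).length = 2).card

/-- Number of arcs (= mid-edges crossed minus one): the additive functional playing `|γ|`. -/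
def arcCount (γ : YBWalk D a z) : ℕ := γ.arcs.length

/-- The pattern-DISCREPANCY functional of the card: the score of the Russo derivative along a
path with log-derivatives `lam = (λ_u, λ_v, λ_w)`, centred by densities `p = (p_u, p_v, p_w)`:
`S^fluct(γ) = Σ_c λ_c (N^c(γ) − p_c · #arcs(γ))`. -/
def discrepancy (lam p : ℝ × ℝ × ℝ) (γ : YBWalk D a z) : ℝ :=
  lam.1 * ((turnCount γ : ℝ) - p.1 * arcCount γ) +
    lam.2.1 * ((straightCount γ : ℝ) - p.2.1 * arcCount γ) +
    lam.2.2 * ((oscCount γ : ℝ) - p.2.2 * arcCount γ)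

/-! ### First lemma (FL1), PROVED: the exponential-tilt identity in the osculation weight -/

/-- Per-face tilt: changing the osculation weight rescales exactly the two-arc faces (mixed two-arc
lists weigh `0` on both sides). -/
theorem fwLocalWeight_tilt_osc (u v w w' : ℝ) (hw : w ≠ 0) (l : List ArcKind) :
    fwLocalWeight u u v w' w' l = (if l.length = 2 then w' / w else 1) * fwLocalWeight u u v w w l := by
  rcases l with _ | ⟨a, _ | ⟨b, _ | ⟨c, l⟩⟩⟩
  · simp
  · cases a <;> simp [fwLocalWeight]
  · cases a <;> cases b <;> simp [fwLocalWeight, div_mul_cancel₀ _ hw]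
  · simp [fwLocalWeight_three]

/-- **FL1 (proved).** `W_{w'}(γ) = (w'/w)^{#osc(γ)} · W_w(γ)`: the algebraic seed of the Russo formula
`d/dt E_t[F] = Cov_t(F, S_t)` for the face-weight exponential family. -/
theorem fwWeight_tilt_osc (u v w w' : ℝ) (hw : w ≠ 0) (γ : YBWalk D a z) :
    fwWeight u u v w' w' γ = (w' / w) ^ oscCount γ * fwWeight u u v w w γ := by
  unfold fwWeight oscCount
  rw [Finset.prod_congr rfl fun f _ => fwLocalWeight_tilt_osc u v w w' hw (γ.kindsIn f),
    Finset.prod_mul_distrib, Finset.prod_ite, Finset.prod_const_one, mul_one, Finset.prod_const]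

end Counts

/-! ### FL1 as Props (the osculation one is inhabited by the theorem above) -/

/-- The tilt identity in the osculation weight, as a `Prop`. -/
def TiltIdentityOsc : Prop :=
  ∀ (D : Set Face) (a z : MidEdge) (u v w w' : ℝ), w ≠ 0 → ∀ γ : YBWalk D a z,
    fwWeight u u v w' w' γ = (w' / w) ^ oscCount γ * fwWeight u u v w w γ

theorem tiltIdentityOsc_holds : TiltIdentityOsc := fun _ _ _ u v w w' hw γ =>
  fwWeight_tilt_osc u v w w' hw γ

/-- Same for the straight (stiffness) weight (provable the same way). -/
def TiltIdentityStraight : Prop :=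
  ∀ (D : Set Face) (a z : MidEdge) (u v v' w : ℝ), v ≠ 0 → ∀ γ : YBWalk D a z,
    fwWeight u u v' w w γ = (v' / v) ^ straightCount γ * fwWeight u u v w w γ

/-! ### First lemma (FL2): vanishing MEAN DENSITY of the critical chordal walk

`E[#faces visited] = o(δ⁻²)`: the mean-density form of Duminil-Copin–Kozma–Yadin's Problem 10
(the critical walk is not space-filling), for the uniform `ℤ²` walk and — what the line needs —
uniformly along a path of face weights. -/
def VanishingMeanDensityZ2 : Prop :=
  ∀ (D : DobrushinDomain) (a b : ℝ → Site 2), SAW.IsEndpointApprox D a b →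
    Tendsto (fun δ : ℝ => δ ^ 2 * ∫ γ, (γ.length : ℝ) ∂(SAW.law D.carrier δ (a δ) (b δ)))
      (𝓝[>] (0 : ℝ)) (𝓝 0)

/-- Uniform-in-`t` mean-density bound with a power saving `η > 0` along a weight path
`ω t = (u, v, w)(t)` (D4-symmetric point `(u, u, v, w, w)`). -/
def VanishingMeanDensityPath (ω : ℝ → ℝ × ℝ × ℝ) : Prop :=
  ∀ (D : DobrushinDomain) (a' b' : ℝ → MidEdge), IsYBEndpointApprox rightAngles D a' b' →
    ∃ η > (0 : ℝ), ∃ C : ℝ, ∀ᶠ δ in 𝓝[>] (0 : ℝ), ∀ t ∈ Icc (0 : ℝ) 1,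
      ∫ γ, (arcCount γ : ℝ)
          ∂(fwLaw (ω t).1 (ω t).1 (ω t).2.1 (ω t).2.2 (ω t).2.2 D.carrier δ (a' δ) (b' δ))
        ≤ C * δ ^ (-(2 : ℝ) + η)

/-! ### First lemma (FL3): the abstract ORTHOGONALITY inequality (probability, provable now)

If the `X i` are centred and pairwise uncorrelated CONDITIONALLY on a sub-σ-algebra `m`, and `f`
is within `η` of an `m`-measurable function, then `|E[f · Σ X_i]| ≤ 2η (Σ E[X_i²])^{1/2}` — the
Lipschitz slack `η` multiplies the `ℓ²`-norm, not the `ℓ¹`-norm, of the block discrepancies. -/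
def OrthogonalityInequality : Prop :=
  ∀ {Ω : Type} {m m0 : MeasurableSpace Ω} (μ : Measure Ω) [IsProbabilityMeasure μ]
    {ι : Type} (s : Finset ι) (X : ι → Ω → ℝ) (f g : Ω → ℝ) (η : ℝ),
    m ≤ m0 → 0 ≤ η →
    (∀ i ∈ s, MemLp (X i) 2 μ) → MemLp f 2 μ → StronglyMeasurable[m] g →
    (∀ ω, |f ω - g ω| ≤ η) →
    (∀ i ∈ s, μ[X i | m] =ᵐ[μ] 0) →
    (∀ i ∈ s, ∀ j ∈ s, i ≠ j → μ[X i * X j | m] =ᵐ[μ] 0) →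
    |∫ ω, f ω * ∑ i ∈ s, X i ω ∂μ| ≤ 2 * η * Real.sqrt (∑ i ∈ s, ∫ ω, (X i ω) ^ 2 ∂μ)

/-! ### The critical path (S4) — criticality as divergence of the full-plane susceptibility -/

/-- Full-plane susceptibility of the D4-symmetric face-weight walk `(u, u, v, w, w)` with an
extra fugacity `s` per arc (walks from `origin` to anywhere; `ℝ≥0∞`-valued). -/
def fwChi (u v w s : ℝ) : ℝ≥0∞ :=
  ∑' z : MidEdge, ∑' γ : YBWalk (Set.univ : Set Face) origin z,
    ENNReal.ofReal (fwWeight u u v w w γ * s ^ arcCount γ)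

/-- The weights `(u, u, v, w, w)` are CRITICAL: the susceptibility converges for every arc
fugacity `s < 1` and diverges at `s = 1`. -/
def IsCriticalFW (u v w : ℝ) : Prop :=
  (∀ s : ℝ, 0 ≤ s → s < 1 → fwChi u v w s < ⊤) ∧ fwChi u v w 1 = ⊤

/-- STUB SHAPE (S4) `CriticalPath`: a continuous path of critical D4-symmetric face weights from
the uniform point `(x_c, x_c, 0)` to Glazman–Manolescu's point `(u₁, v, w₁)(π/2)`, with
osculation and stiffness ratios monotone (pure conditioning directions). -/
def CriticalPath : Prop :=
  ∃ ω : ℝ → ℝ × ℝ × ℝ, ContinuousOn ω (Icc 0 1) ∧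
    (∀ t ∈ Icc (0 : ℝ) 1, IsCriticalFW (ω t).1 (ω t).2.1 (ω t).2.2 ∧ 0 < (ω t).1 ∧
      0 < (ω t).2.1 ∧ 0 ≤ (ω t).2.2) ∧
    ω 0 = (SAW.criticalFugacity, SAW.criticalFugacity, 0) ∧
    ω 1 = (weightU1 (Real.pi / 2), weightV (Real.pi / 2), weightW1 (Real.pi / 2))

/-! ### The residue (S3): mesoscopic conditional pattern theorem, in its bare covariance form

Along the path, the centred pattern discrepancy decorrelates from every bounded Lipschitz shape
functional, uniformly in `t`: `sup_t |Cov_t(F∘curve, S^fluct_t)| → 0`. Stated with abstract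
densities `p t` and log-derivatives `lam t` (their identification with the pressure gradient and
the tangency `Σ_c λ_c p_c = 0` is stub S4's business). -/
def ShapeBlindDiscrepancy (ω lam p : ℝ → ℝ × ℝ × ℝ) : Prop :=
  ∀ (D : DobrushinDomain) (a' b' : ℝ → MidEdge), IsYBEndpointApprox rightAngles D a' b' →
    ∀ (F : BoundedContinuousFunction (CurveClass ℂ) ℝ) (L : ℝ≥0), LipschitzWith L F →
      ∀ ε > (0 : ℝ), ∀ᶠ δ in 𝓝[>] (0 : ℝ), ∀ t ∈ Icc (0 : ℝ) 1,
        |(∫ γ, F (γ.curve rightAngles δ) * discrepancy (lam t) (p t) γ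
            ∂(fwLaw (ω t).1 (ω t).1 (ω t).2.1 (ω t).2.2 (ω t).2.2 D.carrier δ (a' δ) (b' δ))) -
          (∫ γ, F (γ.curve rightAngles δ)
            ∂(fwLaw (ω t).1 (ω t).1 (ω t).2.1 (ω t).2.2 (ω t).2.2 D.carrier δ (a' δ) (b' δ))) *
          ∫ γ, discrepancy (lam t) (p t) γ
            ∂(fwLaw (ω t).1 (ω t).1 (ω t).2.1 (ω t).2.2 (ω t).2.2 D.carrier δ (a' δ) (b' δ))|
          ≤ ε

/-- THE TARGET the idea serves: birth's kernel `K = LipUnifToYB` (by name). The intended line is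
`CriticalPath ∧ (Russo/FTC, provable) ∧ VanishingMeanDensityPath ∧ (linear conditional variance)
∧ ShapeBlindDiscrepancy(coarse) → LipUnifToYB`, then birth: `T(1881) → Z → K → YBtoUniform`. -/
example : Prop := LipUnifToYB

/-- Sanity: the crux itself, by name. -/
example : Prop := SAWTrackTransport.YBtoUniform

end Summit.CriticalPhenomena.SAWScalingLimit.Cruxes.YBtoUniform.CriticalSurfaceOrthogonality

end
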